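import Summits.Ventures.WeilGRH.FlatWindowConstantsExact
import Literature.NumberTheory.LFunctions.RiemannSiegelStirling
import HarnessLib

/-!
# rh-explicit (venture WeilGRH): the two archimedean constants of the `ζ` window form collapse —
  `K₀ + Re ψ(¼) = log π` — and second-order Stirling on the quarter line, `Re ψ(¼+iτ/2) ≤ log(|τ|/2) + 2/τ²`

Cell `rh-explicit`, WEIL TRACK (structure seat weil-3, gen11).  RH/GRH-free; constants only.  In the `ζ` window
form of the flat window modulated to height `τ` (`ZetaWindowAtoms.weilWindowForm_modulated_chi_zero`) the
archimedean place contributes `−K₀ + ∫₀^∞ρ₀(t)(2(1 − cos τt) + cos(τt)min(t,2a)/a)dt` with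
`K₀ = log 4π + γ + 2∫₀^∞(e^{t/2} − 1)dt/(2 sinh t)` and `∫ρ₀·2(1 − cos τt) = Re ψ(¼+iτ/2) − Re ψ(¼)`
(`TwistedModulationCost`).  Two facts make this part explicit in the height:

* `flatWindow_const_zero_add_reDigammaQuarter_zero`: **`K₀ + Re ψ(¼) = log π`** (`K₀ = log 8π + γ + π/2` and Gauss
  `ψ(¼) = −γ − π/2 − 3 log 2`, both `FlatWindowConstantsExact`);
* **`reDigammaQuarter_le_log_half_add`**: `Re ψ(¼ + iτ/2) ≤ log(|τ|/2) + 2/τ²` for `|τ| ≥ 2` (second-order Stirling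
  `RiemannSiegelStirling.abs_re_digamma_sub_log_norm_add_re_le` at `w = ¼ + i|τ|/2`: `Re(1/2w) ≥ 0`,
  `log‖w‖ ≤ log(|τ|/2) + 1/(8τ²)`, `1/8 + 2/3 + π/3 ≤ 2`);
* `archConstants_le_log_height`: `−K₀ + [Re ψ(¼+iτ/2) − Re ψ(¼)] ≤ log(|τ|/(2π)) + 2/τ²` for `|τ| ≥ 2` (compare
  `WindowBudgetGoldstonGonek.archConstants_le_log`: `≤ log(1+|τ|) + 3 − log π`, i.e. `4.57` vs the true `0.81` at
  `γ₁ = 14.13`).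

With the oscillation bound of `ModulationCostOscillation` (`|∫ρ_κ min(t,2a)cos(τt)| ≤ 2/|τ| + 2/τ²`) this gives the
phase-blind window budget of `ZetaWindowPhaseBlind.lean`.

No definitions, no named facts; RH-free.
-/

set_option autoImplicit false

noncomputable section

open Complex Filter Set MeasureTheory
open scoped Real Topology

namespace Summit.Ventures.WeilGRH

open Literature.NumberTheory.LFunctions
open Literature.Analysis.SpecialFunctions (reDigammaQuarter reDigammaQuarter_zero reDigammaQuarter_even)

/-! ## The constants -/

/-- **`K₀ + Re ψ(¼) = log π`**: `K₀ = log 4π + γ + 2∫₀^∞(e^{t/2} − 1)dt/(2 sinh t) = log 8π + γ + π/2` and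
`Re ψ(¼) = ψ(¼) = −γ − π/2 − 3 log 2` (Gauss), so the two archimedean constants of the `ζ` window form collapse
to `log π`. -/
theorem flatWindow_const_zero_add_reDigammaQuarter_zero :
    (Real.log (4 * π) + Real.eulerMascheroniConstant +
        2 * ∫ t in Ioi (0 : ℝ), (Real.exp (t / 2) - 1) / (2 * Real.sinh t)) + reDigammaQuarter 0 =
      Real.log π := by
  have hK : Real.log (4 * π) + Real.eulerMascheroniConstant +
      2 * ∫ t in Ioi (0 : ℝ), (Real.exp (t / 2) - 1) / (2 * Real.sinh t) =
      Real.log π - (Complex.digamma (1 / 4)).re := by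
    rw [← flatWindow_const_zero_eq_digamma]
    simp_rw [weilKillingDensityPar_zero_eq]
  rw [hK, reDigammaQuarter_zero]
  ring

/-- **Second-order Stirling on the quarter line, upper side**: `Re ψ(¼ + iτ/2) ≤ log(|τ|/2) + 2/τ²` for
`|τ| ≥ 2` (`Re ψ(w) ≤ log‖w‖ − Re(1/2w) + 1/(6|Im w|³) + π/(12 Im w²)` at `w = ¼ + i|τ|/2`, `Re(1/2w) ≥ 0`,
`log‖w‖ ≤ log(|τ|/2) + 1/(8τ²)`, `1/8 + 2/3 + π/3 ≤ 2`). -/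
theorem reDigammaQuarter_le_log_half_add {τ : ℝ} (hτ : 2 ≤ |τ|) :
    reDigammaQuarter τ ≤ Real.log (|τ| / 2) + 2 / τ ^ 2 := by
  -- reduce to `τ > 0`
  set u : ℝ := |τ| with hu
  have hu2 : 2 ≤ u := hτ
  have hu0 : 0 < u := by linarith
  have hsq : τ ^ 2 = u ^ 2 := (sq_abs τ).symm
  have hRu : reDigammaQuarter τ = reDigammaQuarter u := by
    rcases abs_choice τ with h | h
    · rw [hu, h]
    · rw [hu, h, reDigammaQuarter_even]
  rw [hRu, hsq]
  set w : ℂ := 1 / 4 + u / 2 * I with hw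
  have hwre : w.re = 1 / 4 := by simp [hw]
  have hwim : w.im = u / 2 := by simp [hw]
  have hR : reDigammaQuarter u = (Complex.digamma w).re := rfl
  have hune : u ≠ 0 := hu0.ne'
  have hu2pos : (0 : ℝ) < u / 2 := by positivity
  have h1 := Literature.NumberTheory.LFunctions.Complex.abs_re_digamma_sub_log_norm_add_re_le
    (w := w) (by rw [hwre]; norm_num) (by rw [hwim]; exact hu2pos.ne')
  rw [hwim, abs_of_pos hu2pos] at h1
  -- `Re(1/(2w)) ≥ 0`
  have hinv : 0 ≤ (1 / (2 * w)).re := by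
    rw [one_div, Complex.inv_re]
    refine div_nonneg ?_ (Complex.normSq_nonneg _)
    norm_num [hw]
  -- `log ‖w‖ ≤ log(u/2) + 1/(8u²)`
  have hnormsq : ‖w‖ ^ 2 = 1 / 16 + u ^ 2 / 4 := by
    rw [Complex.sq_norm, Complex.normSq_apply, hwre, hwim]; ring
  have hnorm_ge : u / 2 ≤ ‖w‖ := by
    have := Complex.abs_im_le_norm w
    rwa [hwim, abs_of_pos (by positivity : (0 : ℝ) < u / 2)] at this
  have hnorm_pos : 0 < ‖w‖ := by linarith
  have hlog_hi : Real.log ‖w‖ ≤ Real.log (u / 2) + 1 / (8 * u ^ 2) := by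
    have h2 : Real.log ‖w‖ = Real.log (‖w‖ ^ 2) / 2 := by
      rw [Real.log_pow]; push_cast; ring
    have h3 : Real.log (u / 2) = Real.log ((u / 2) ^ 2) / 2 := by
      rw [Real.log_pow]; push_cast; ring
    rw [h2, h3, hnormsq]
    have h4 : Real.log (1 / 16 + u ^ 2 / 4) ≤ Real.log ((u / 2) ^ 2) + 1 / (4 * u ^ 2) := by
      have h5 : 1 / 16 + u ^ 2 / 4 = (u / 2) ^ 2 * (1 + 1 / (4 * u ^ 2)) := by field_simp; ring
      rw [h5, Real.log_mul (by positivity) (by positivity)]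
      have := Real.log_le_sub_one_of_pos (show 0 < 1 + 1 / (4 * u ^ 2) by positivity)
      linarith
    have : 1 / (4 * u ^ 2) / 2 = 1 / (8 * u ^ 2) := by ring
    linarith [this]
  -- the error terms: `1/(8u²) + 1/(6(u/2)³) + π/(12(u/2)²) ≤ 2/u²` for `u ≥ 2`
  have hpi := Real.pi_lt_d2
  have herr : 1 / (8 * u ^ 2) + (1 / (6 * (u / 2) ^ 3) + π / (12 * (u / 2) ^ 2)) ≤ 2 / u ^ 2 := by
    rw [show 1 / (6 * (u / 2) ^ 3) = 4 / (3 * u ^ 3) by field_simp; ring,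
      show π / (12 * (u / 2) ^ 2) = π / 3 / u ^ 2 by field_simp; ring]
    have hu3 : 4 / (3 * u ^ 3) ≤ 2 / 3 / u ^ 2 := by
      rw [div_le_div_iff₀ (by positivity) (by positivity)]
      nlinarith [pow_pos hu0 2]
    have hsum : 1 / (8 * u ^ 2) + (2 / 3 / u ^ 2 + π / 3 / u ^ 2) ≤ 2 / u ^ 2 := by
      rw [show 1 / (8 * u ^ 2) + (2 / 3 / u ^ 2 + π / 3 / u ^ 2) = (1 / 8 + 2 / 3 + π / 3) / u ^ 2 by
        field_simp; ring]
      exact div_le_div_of_nonneg_right (by linarith) (by positivity)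
    linarith
  rw [hR]
  have := (abs_le.1 h1).2
  linarith

/-- **`−K₀ + [Re ψ(¼+iτ/2) − Re ψ(¼)] ≤ log(|τ|/(2π)) + 2/τ²`** for `|τ| ≥ 2`: the archimedean constants of the `ζ`
window form at height `τ`, explicit in the height. -/
theorem archConstants_le_log_height {τ : ℝ} (hτ : 2 ≤ |τ|) :
    -(Real.log (4 * π) + Real.eulerMascheroniConstant +
          2 * ∫ t in Ioi (0 : ℝ), (Real.exp (t / 2) - 1) / (2 * Real.sinh t)) +
        (reDigammaQuarter τ - reDigammaQuarter 0) ≤ Real.log (|τ| / (2 * π)) + 2 / τ ^ 2 := by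
  have h2 := flatWindow_const_zero_add_reDigammaQuarter_zero
  have h3 := reDigammaQuarter_le_log_half_add hτ
  have hu0 : 0 < |τ| := by linarith
  have hlog : Real.log (|τ| / (2 * π)) = Real.log (|τ| / 2) - Real.log π := by
    rw [show |τ| / (2 * π) = |τ| / 2 / π by ring, Real.log_div (by positivity) Real.pi_pos.ne']
  rw [hlog]
  linarith

end Summit.Ventures.WeilGRH

end
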